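import Summits.QuantumFields.YangMills.Theorems.FluctuationComparisonRegPrIntLS2BetaIrrOfCentralStab
import Summits.QuantumFields.YangMills.Theorems.FluctuationComparisonRegPrIntLS2BetaCentralStabOfIrr
import Summits.QuantumFields.YangMills.Theorems.FluctuationComparisonRegPrIntLS2BetaNearSymmetryRigidity
import Mathlib.Analysis.Normed.Module.FiniteDimension
import HarnessLib

/-!
# S2β · seam (b) — (T7f) THE IRREDUCIBLE LOCUS IS OPEN AND THE NEAR-SYMMETRY RIGIDITY CONSTANT IS LOCALLY UNIFORM ON IT

Cell `ym3-torus` (YM ladder rung R3 = continuum `SU(2)` Yang–Mills on the three-torus at fixed lattice data — a RUNG: NOT d = 4, NOT infinite volume,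
NOT a mass gap, NOT Clay).  Width seat `ym3-torus-px21` (gen 19), the (T)-chain of LINE g18-1 S2β ((T7a)–(T7e)).  Crux `stmt-QuantumFields-20520`
(`…Theses.UnitScaleTilt.FluctuationComparisonRegPrIntL`); `--kind proof --supports stmt-QuantumFields-20520 --as helper`, count-neutral, DEFINITION-FREE
(0 `def`, 0 `instance`, 0 `notation`, 0 `sorry`, default heartbeats).

WHY.  ✓(T7a) `exists_near_scalar_of_irr` gives the near-symmetry rigidity constant `K_V` ONE DATUM AT A TIME; every per-datum constant of ✓(T7b)∕(T7c)∕(T7e)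
(`M = 1 + 2√#B_K·K_V·√#B_J·Kπ`, hence POS∘'s `c`, TUBE♭'s and GAP♭'s `μ`) inherits its datum dependence from `K_V` alone (pen 3's rate, px13's `Kπ`, `#bonds` are datum-free).
UV3-NODE §40.3 (RECORD 17gh) located the obstruction to uniformity: `K_V → ∞` as the stabiliser JUMPS (`V → 1`).  THIS FILE proves the complementary positive statement —
AWAY from a jump the constant is locally uniform:
* §1 `norm_comm_sub_comm_le` — the bond commutator is Lipschitz in the datum: `‖(sV′ − V′s′) − (sV − Vs′)‖ ≤ (‖s‖ + ‖s′‖)·‖V′ − V‖`.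
* §2 ★★ `exists_antilipschitz_comm_locUnif_of_irr` — IRR(V) ⟹ `∃ K_V ≥ 0, t > 0` such that for EVERY datum `V′` with `‖V′_b − V_b‖ ≤ t` on all bonds and EVERY matrix
  section `s`: `‖s(y) − ½tr(s x₀)·1‖ ≤ K_V·‖(s(b₋)V′_b − V′_b s(b₊))_b‖_∞` (perturbation of the anti-Lipschitz constant `K` of (T7a)'s map `(T_V, tr∘ev_{x₀})`:
  `‖e‖ ≤ K‖T_V e‖ ≤ K(‖T_{V′} e‖ + 2t‖e‖)`, `t := 1∕(8K+1)`, so `‖e‖ ≤ 2K‖T_{V′} e‖`).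
* §3 ★ `irr_of_near_irr` (IRREDUCIBILITY IS OPEN: the sup-ball consists of irreducible data), ★ `centralStab_of_near_centralStab` (pen 4's token edition, via ✓(T7d)
  `irr_of_centralStab` + ✓pen 6 `centralStab_of_irr`), ★★ `exists_near_scalar_locUnif_of_irr` ((T7a) §2's conclusion with ONE `K_V` on the ball) — so the per-datum
  constants of (T7b)∕(T7c)∕(T7e) are LOCALLY UNIFORM on the (open) irreducible locus and uniform on its compact subsets; NEVER across a stabiliser jump.

HONEST: finite-dimensional linear algebra; nothing of Bałaban's analysis; the organ's datum-free `δ`∕`μ` (TUBE-REG∘ as registered — it needs uniformity ACROSS the jump at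
`V = 1`, i.e. print's chart currency, RECORD 17gh), GAP♯∘, the reducible `hlift`, EXW∘, S2β, crux 20520 NOT proved; no summit statement is proved by a helper; finite-volume ∕
conditional; rung R3 = SU(2) YM₃ on T³ — NOT d = 4, NOT infinite volume, NOT a mass gap, NOT Clay; the Yang–Mills mass gap is NOT proved.  Sorry-free, axioms standard.

References: T. Bałaban, CMP **102** (1985) 277–309 [Balaban1985Variational] ((4) p.278, Prop. 7 and (141)–(143) p.299); CMP **98** (1985) 17–51 [Balaban1985Averaging] ((8) p.19).
-/

set_option autoImplicit false

noncomputable section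

namespace Summit.QuantumFields.YangMills.Theorems.FluctuationComparisonRegPrIntLS2BetaNearSymmetryRigidityLocUnif

open Set Filter Topology Function
open scoped Matrix.Norms.L2Operator
open Literature.MathematicalPhysics.QuantumFieldTheory.Balaban1983to89
open Literature.MathematicalPhysics.QuantumFieldTheory.Balaban1983to89.T3ContinuumYM3Torus
open Summit.QuantumFields.YangMills.Theorems.BrascampLiebVacuumSC.DimensionGapSU2 (neg_one_mem)
open Summit.QuantumFields.YangMills.Theorems.FluctuationComparisonRegPrIntLS2BetaNearSymmetryRigidity (norm_comm_sub_eq_dist1)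
open Summit.QuantumFields.YangMills.Theorems.FluctuationComparisonRegPrIntLS2BetaIrrOfCentralStab (irr_of_centralStab)
open Summit.QuantumFields.YangMills.Theorems.FluctuationComparisonRegPrIntLS2BetaCentralStabOfIrr (centralStab_of_irr)

/-! ## §1 The commutator map is Lipschitz in the datum -/

section Lip

/-- **THE BOND COMMUTATOR IS LIPSCHITZ IN THE DATUM**: `‖(sV′ − V′s′) − (sV − Vs′)‖ ≤ (‖s‖ + ‖s′‖)·‖V′ − V‖`. [folklore] -/
theorem norm_comm_sub_comm_le (s s' V V' : Matrix (Fin 2) (Fin 2) ℂ) :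
    ‖(s * V' - V' * s') - (s * V - V * s')‖ ≤ (‖s‖ + ‖s'‖) * ‖V' - V‖ := by
  have h : (s * V' - V' * s') - (s * V - V * s') = s * (V' - V) - (V' - V) * s' := by
    simp only [mul_sub, sub_mul]; abel
  rw [h]
  calc ‖s * (V' - V) - (V' - V) * s'‖ ≤ ‖s * (V' - V)‖ + ‖(V' - V) * s'‖ := norm_sub_le _ _
    _ ≤ ‖s‖ * ‖V' - V‖ + ‖V' - V‖ * ‖s'‖ := add_le_add (norm_mul_le _ _) (norm_mul_le _ _)
    _ = (‖s‖ + ‖s'‖) * ‖V' - V‖ := by ring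

end Lip

/-! ## §2 The core estimate: one anti-Lipschitz constant for the commutator maps of all data near an irreducible datum -/

section Core

variable (F : T3Family) {J : ℕ}

/-- ★★ **LOCALLY UNIFORM ANTI-LIPSCHITZ BOUND FOR THE COMMUTATOR MAP (matrix-valued sections).**  If the commutant of `V` is scalar (IRR(V)), there are `K_V ≥ 0` and `t > 0` such
that for EVERY datum `V′` with `‖V′_b − V_b‖ ≤ t` on all bonds and EVERY `s : sites → M₂(ℂ)`:
`‖s(y) − ½tr(s x₀)·1‖ ≤ K_V·‖(s(b₋)V′_b − V′_b s(b₊))_b‖_∞` (`x₀ = default`).  Perturbation of the anti-Lipschitz constant `K` of `(T_V, tr∘ev_{x₀})` (✓(T7a)'s map):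
`‖e‖ ≤ K‖T_V e‖ ≤ K(‖T_{V′} e‖ + 2t‖e‖)` with `2Kt ≤ ½` (`t := 1∕(8K+1)`), so `‖e‖ ≤ 2K‖T_{V′} e‖`.  NOT uniform across a stabiliser jump (`K_V → ∞` as `V → 1`).
[cite: Balaban1985Variational, (4) p.278, Prop. 7 p.299; Balaban1985Averaging, (8) p.19] -/
theorem exists_antilipschitz_comm_locUnif_of_irr (V : GaugeField (F.P J) 0 (Matrix.specialUnitaryGroup (Fin 2) ℂ))
    (hirr : ∀ s : Site (F.P J) 0 → Matrix (Fin 2) (Fin 2) ℂ,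
      (∀ b : PBond (F.P J) 0, s b.src * (V b : Matrix (Fin 2) (Fin 2) ℂ) = (V b : Matrix (Fin 2) (Fin 2) ℂ) * s b.tgt) → ∃ c : ℂ, ∀ x, s x = c • (1 : Matrix (Fin 2) (Fin 2) ℂ)) :
    ∃ KV t : ℝ, 0 ≤ KV ∧ 0 < t ∧
      ∀ V' : GaugeField (F.P J) 0 (Matrix.specialUnitaryGroup (Fin 2) ℂ),
        (∀ b : PBond (F.P J) 0, ‖(V' b : Matrix (Fin 2) (Fin 2) ℂ) - (V b : Matrix (Fin 2) (Fin 2) ℂ)‖ ≤ t) →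
        ∀ s : Site (F.P J) 0 → Matrix (Fin 2) (Fin 2) ℂ,
          ∀ y, ‖s y - (Matrix.trace (s default) / 2) • (1 : Matrix (Fin 2) (Fin 2) ℂ)‖ ≤
            KV * ‖fun b : PBond (F.P J) 0 => s b.src * (V' b : Matrix (Fin 2) (Fin 2) ℂ) - (V' b : Matrix (Fin 2) (Fin 2) ℂ) * s b.tgt‖ := by
  classical
  -- the linear map at the base datum `V`, as in (T7a)
  let T : (Site (F.P J) 0 → Matrix (Fin 2) (Fin 2) ℂ) →ₗ[ℂ] (PBond (F.P J) 0 → Matrix (Fin 2) (Fin 2) ℂ) × ℂ :=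
    { toFun := fun s => (fun b => s b.src * (V b : Matrix (Fin 2) (Fin 2) ℂ) - (V b : Matrix (Fin 2) (Fin 2) ℂ) * s b.tgt, Matrix.trace (s default))
      map_add' := fun s t => by
        refine Prod.ext (funext fun b => ?_) ?_
        · simp only [Pi.add_apply, add_mul, mul_add, Prod.fst_add]
          abel
        · simp only [Pi.add_apply, Matrix.trace_add, Prod.snd_add]
      map_smul' := fun c s => by
        refine Prod.ext (funext fun b => ?_) ?_
        · simp only [Pi.smul_apply, Matrix.smul_mul, Matrix.mul_smul, smul_sub, RingHom.id_apply, Prod.smul_fst]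
        · simp only [Pi.smul_apply, Matrix.trace_smul, RingHom.id_apply, Prod.smul_snd] }
  have hT : ∀ s : Site (F.P J) 0 → Matrix (Fin 2) (Fin 2) ℂ,
      T s = (fun b => s b.src * (V b : Matrix (Fin 2) (Fin 2) ℂ) - (V b : Matrix (Fin 2) (Fin 2) ℂ) * s b.tgt, Matrix.trace (s default)) := fun _ => rfl
  have hker : LinearMap.ker T = ⊥ := by
    refine LinearMap.ker_eq_bot'.mpr fun s hs => ?_
    rw [hT] at hs
    have h1 : ∀ b : PBond (F.P J) 0, s b.src * (V b : Matrix (Fin 2) (Fin 2) ℂ) = (V b : Matrix (Fin 2) (Fin 2) ℂ) * s b.tgt := by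
      intro b
      have := congrFun (congrArg Prod.fst hs) b
      exact sub_eq_zero.mp this
    have h2 : Matrix.trace (s default) = 0 := congrArg Prod.snd hs
    obtain ⟨c, hc⟩ := hirr s h1
    have hc0 : c = 0 := by
      rw [hc default, Matrix.trace_smul, Matrix.trace_one, Fintype.card_fin] at h2
      norm_num at h2
      exact h2
    funext x
    rw [hc x, hc0, zero_smul, Pi.zero_apply]
  obtain ⟨Kc, _hKc, hanti⟩ := T.exists_antilipschitzWith hker
  refine ⟨2 * Kc, 1 / (8 * Kc + 1), by positivity, by positivity, fun V' hV' s y => ?_⟩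
  set a : ℂ := Matrix.trace (s default) / 2 with ha
  set e : Site (F.P J) 0 → Matrix (Fin 2) (Fin 2) ℂ := fun y => s y - a • 1 with he
  obtain ⟨C, hC⟩ : ∃ C : PBond (F.P J) 0 → Matrix (Fin 2) (Fin 2) ℂ, C = fun b => s b.src * (V' b : Matrix (Fin 2) (Fin 2) ℂ) - (V' b : Matrix (Fin 2) (Fin 2) ℂ) * s b.tgt := ⟨_, rfl⟩
  rw [← hC]
  -- `T e = ((commutator at V)_b, 0)`
  have hTe1 : ∀ b : PBond (F.P J) 0, (T e).1 b = e b.src * (V b : Matrix (Fin 2) (Fin 2) ℂ) - (V b : Matrix (Fin 2) (Fin 2) ℂ) * e b.tgt := fun b => by rw [hT]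
  have hTe2 : (T e).2 = 0 := by
    rw [hT]
    show Matrix.trace (e default) = 0
    simp only [he, Matrix.trace_sub, Matrix.trace_smul, Matrix.trace_one, Fintype.card_fin, ha]
    norm_num
  have hey : ∀ z, ‖e z‖ ≤ ‖e‖ := fun z => norm_le_pi_norm e z
  have he0 : 0 ≤ ‖e‖ := norm_nonneg _
  have hC0 : 0 ≤ ‖C‖ := norm_nonneg _
  -- the commutator of `e` at `V′` IS the commutator of `s` at `V′` (the scalar part commutes), bounded by `‖C‖`
  have hCe : ∀ b : PBond (F.P J) 0, e b.src * (V' b : Matrix (Fin 2) (Fin 2) ℂ) - (V' b : Matrix (Fin 2) (Fin 2) ℂ) * e b.tgt = C b := by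
    intro b
    rw [hC]
    simp only [he, sub_mul, mul_sub, Matrix.smul_mul, Matrix.mul_smul, one_mul, mul_one]; abel
  -- each commutator at `V` is within `2‖e‖·t` of the one at `V′`
  have hcomm : ∀ b : PBond (F.P J) 0, ‖(T e).1 b‖ ≤ ‖C‖ + 2 * ‖e‖ * (1 / (8 * Kc + 1)) := by
    intro b
    rw [hTe1]
    have hB : ‖e b.src * (V' b : Matrix (Fin 2) (Fin 2) ℂ) - (V' b : Matrix (Fin 2) (Fin 2) ℂ) * e b.tgt‖ ≤ ‖C‖ := by rw [hCe]; exact norm_le_pi_norm C b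
    have hD : ‖(e b.src * (V b : Matrix (Fin 2) (Fin 2) ℂ) - (V b : Matrix (Fin 2) (Fin 2) ℂ) * e b.tgt) - (e b.src * (V' b : Matrix (Fin 2) (Fin 2) ℂ) - (V' b : Matrix (Fin 2) (Fin 2) ℂ) * e b.tgt)‖ ≤
        2 * ‖e‖ * (1 / (8 * Kc + 1)) := by
      rw [norm_sub_rev]
      refine (norm_comm_sub_comm_le (e b.src) (e b.tgt) (V b : Matrix (Fin 2) (Fin 2) ℂ) (V' b : Matrix (Fin 2) (Fin 2) ℂ)).trans ?_
      have h1 : ‖e b.src‖ + ‖e b.tgt‖ ≤ 2 * ‖e‖ := by have := hey b.src; have := hey b.tgt; linarith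
      exact mul_le_mul h1 (hV' b) (norm_nonneg _) (by positivity)
    calc ‖e b.src * (V b : Matrix (Fin 2) (Fin 2) ℂ) - (V b : Matrix (Fin 2) (Fin 2) ℂ) * e b.tgt‖
        = ‖(e b.src * (V' b : Matrix (Fin 2) (Fin 2) ℂ) - (V' b : Matrix (Fin 2) (Fin 2) ℂ) * e b.tgt) +
            ((e b.src * (V b : Matrix (Fin 2) (Fin 2) ℂ) - (V b : Matrix (Fin 2) (Fin 2) ℂ) * e b.tgt) - (e b.src * (V' b : Matrix (Fin 2) (Fin 2) ℂ) - (V' b : Matrix (Fin 2) (Fin 2) ℂ) * e b.tgt))‖ := by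
          rw [add_sub_cancel]
      _ ≤ ‖e b.src * (V' b : Matrix (Fin 2) (Fin 2) ℂ) - (V' b : Matrix (Fin 2) (Fin 2) ℂ) * e b.tgt‖ +
            ‖(e b.src * (V b : Matrix (Fin 2) (Fin 2) ℂ) - (V b : Matrix (Fin 2) (Fin 2) ℂ) * e b.tgt) - (e b.src * (V' b : Matrix (Fin 2) (Fin 2) ℂ) - (V' b : Matrix (Fin 2) (Fin 2) ℂ) * e b.tgt)‖ := norm_add_le _ _
      _ ≤ ‖C‖ + 2 * ‖e‖ * (1 / (8 * Kc + 1)) := add_le_add hB hD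
  have hTe : ‖T e‖ ≤ ‖C‖ + 2 * ‖e‖ * (1 / (8 * Kc + 1)) := by
    rw [Prod.norm_def, hTe2, norm_zero, max_eq_left (norm_nonneg _)]
    exact (pi_norm_le_iff_of_nonneg (by positivity)).mpr hcomm
  -- anti-Lipschitz at `V`, then absorb the `‖e‖`-term
  have h1 : ‖e‖ ≤ Kc * ‖T e‖ := by
    have h := hanti.le_mul_dist e 0
    rwa [dist_zero_right, map_zero, dist_zero_right] at h
  have hKc0 : (0 : ℝ) ≤ Kc := Kc.coe_nonneg
  have habs : (Kc : ℝ) * (2 * (1 / (8 * Kc + 1))) ≤ 1 / 2 := by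
    rw [show (Kc : ℝ) * (2 * (1 / (8 * Kc + 1))) = 2 * Kc / (8 * Kc + 1) by ring, div_le_iff₀ (by positivity)]
    linarith
  have h2 : ‖e‖ ≤ (Kc : ℝ) * ‖C‖ + (1 / 2) * ‖e‖ := by
    calc ‖e‖ ≤ Kc * ‖T e‖ := h1
      _ ≤ Kc * (‖C‖ + 2 * ‖e‖ * (1 / (8 * Kc + 1))) := mul_le_mul_of_nonneg_left hTe hKc0
      _ = Kc * ‖C‖ + (Kc * (2 * (1 / (8 * Kc + 1)))) * ‖e‖ := by ring
      _ ≤ Kc * ‖C‖ + (1 / 2) * ‖e‖ := by have := mul_le_mul_of_nonneg_right habs he0; linarith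
  have h3 : ‖e‖ ≤ 2 * Kc * ‖C‖ := by linarith
  calc ‖s y - a • 1‖ = ‖e y‖ := rfl
    _ ≤ ‖e‖ := hey y
    _ ≤ 2 * Kc * ‖C‖ := h3

end Core

/-! ## §3 Consequences: openness of the irreducible locus; locally uniform near-symmetry rigidity -/

section Consequences

variable (F : T3Family) {J : ℕ}

/-- ★ **IRREDUCIBILITY IS AN OPEN CONDITION**: every datum in the sup-ball of §2 about an irreducible `V` is irreducible (a commutant element `s` of `V′` has vanishing
commutator, so `s = ½tr(s x₀)·𝟙` by §2). [cite: Balaban1985Variational, (4) p.278] -/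
theorem irr_of_near_irr (V : GaugeField (F.P J) 0 (Matrix.specialUnitaryGroup (Fin 2) ℂ))
    (hirr : ∀ s : Site (F.P J) 0 → Matrix (Fin 2) (Fin 2) ℂ,
      (∀ b : PBond (F.P J) 0, s b.src * (V b : Matrix (Fin 2) (Fin 2) ℂ) = (V b : Matrix (Fin 2) (Fin 2) ℂ) * s b.tgt) → ∃ c : ℂ, ∀ x, s x = c • (1 : Matrix (Fin 2) (Fin 2) ℂ)) :
    ∃ t : ℝ, 0 < t ∧ ∀ V' : GaugeField (F.P J) 0 (Matrix.specialUnitaryGroup (Fin 2) ℂ),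
      (∀ b : PBond (F.P J) 0, ‖(V' b : Matrix (Fin 2) (Fin 2) ℂ) - (V b : Matrix (Fin 2) (Fin 2) ℂ)‖ ≤ t) →
      ∀ s : Site (F.P J) 0 → Matrix (Fin 2) (Fin 2) ℂ,
        (∀ b : PBond (F.P J) 0, s b.src * (V' b : Matrix (Fin 2) (Fin 2) ℂ) = (V' b : Matrix (Fin 2) (Fin 2) ℂ) * s b.tgt) → ∃ c : ℂ, ∀ x, s x = c • (1 : Matrix (Fin 2) (Fin 2) ℂ) := by
  obtain ⟨KV, t, hKV, ht, H⟩ := exists_antilipschitz_comm_locUnif_of_irr F V hirr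
  refine ⟨t, ht, fun V' hV' s hs => ⟨Matrix.trace (s default) / 2, fun x => ?_⟩⟩
  have h0 : (fun b : PBond (F.P J) 0 => s b.src * (V' b : Matrix (Fin 2) (Fin 2) ℂ) - (V' b : Matrix (Fin 2) (Fin 2) ℂ) * s b.tgt) = 0 := by
    funext b; rw [Pi.zero_apply]; exact sub_eq_zero.mpr (hs b)
  have h := H V' hV' s x
  rw [h0, norm_zero, mul_zero] at h
  exact sub_eq_zero.mp (norm_le_zero_iff.mp h)

/-- ★ **THE CENTRAL-STABILISER LOCUS IS OPEN** (pen 4's token edition, through ✓(T7d) `irr_of_centralStab` and ✓pen 6 `centralStab_of_irr`). [cite: Balaban1985Variational, (4) p.278, Prop. 7 p.299] -/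
theorem centralStab_of_near_centralStab (V : GaugeField (F.P J) 0 (Matrix.specialUnitaryGroup (Fin 2) ℂ))
    (hstab : ∀ s : GaugeTransf (F.P J) 0 (Matrix.specialUnitaryGroup (Fin 2) ℂ), GaugeField.gaugeAct s V = V →
      s = (fun _ => 1) ∨ s = (fun _ => (⟨-1, neg_one_mem⟩ : Matrix.specialUnitaryGroup (Fin 2) ℂ))) :
    ∃ t : ℝ, 0 < t ∧ ∀ V' : GaugeField (F.P J) 0 (Matrix.specialUnitaryGroup (Fin 2) ℂ),
      (∀ b : PBond (F.P J) 0, ‖(V' b : Matrix (Fin 2) (Fin 2) ℂ) - (V b : Matrix (Fin 2) (Fin 2) ℂ)‖ ≤ t) →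
      ∀ s : GaugeTransf (F.P J) 0 (Matrix.specialUnitaryGroup (Fin 2) ℂ), GaugeField.gaugeAct s V' = V' →
        s = (fun _ => 1) ∨ s = (fun _ => (⟨-1, neg_one_mem⟩ : Matrix.specialUnitaryGroup (Fin 2) ℂ)) := by
  obtain ⟨t, ht, H⟩ := irr_of_near_irr F V (irr_of_centralStab F V hstab)
  exact ⟨t, ht, fun V' hV' => centralStab_of_irr F V' (H V' hV')⟩

/-- ★★ **LOCALLY UNIFORM NEAR-SYMMETRY RIGIDITY** — ✓(T7a) §2 `exists_near_scalar_of_irr`'s conclusion with ONE constant `K_V` for EVERY datum `V′` in a sup-ball about the irreducible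
`V`: `‖s(y) − a·1‖ ≤ K_V·(Σ_b dist1 ((s•V′) b·(V′ b)⁻¹)²)^{1/2}`.  Consequently the per-datum constants of ✓(T7b)∕(T7c)∕(T7e) (`M = 1 + 2√#B_K·K_V·√#B_J·Kπ`) are locally uniform on the
(open) irreducible locus and uniform on its compact subsets — never across a stabiliser jump. [cite: Balaban1985Variational, (4) p.278, (141)-(143) p.299; Balaban1985Averaging, (8) p.19] -/
theorem exists_near_scalar_locUnif_of_irr (V : GaugeField (F.P J) 0 (Matrix.specialUnitaryGroup (Fin 2) ℂ))
    (hirr : ∀ s : Site (F.P J) 0 → Matrix (Fin 2) (Fin 2) ℂ,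
      (∀ b : PBond (F.P J) 0, s b.src * (V b : Matrix (Fin 2) (Fin 2) ℂ) = (V b : Matrix (Fin 2) (Fin 2) ℂ) * s b.tgt) → ∃ c : ℂ, ∀ x, s x = c • (1 : Matrix (Fin 2) (Fin 2) ℂ)) :
    ∃ KV t : ℝ, 0 ≤ KV ∧ 0 < t ∧
      ∀ V' : GaugeField (F.P J) 0 (Matrix.specialUnitaryGroup (Fin 2) ℂ),
        (∀ b : PBond (F.P J) 0, ‖(V' b : Matrix (Fin 2) (Fin 2) ℂ) - (V b : Matrix (Fin 2) (Fin 2) ℂ)‖ ≤ t) →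
        ∀ s : Site (F.P J) 0 → Matrix.specialUnitaryGroup (Fin 2) ℂ, ∃ a : ℂ,
          ∀ y, ‖(s y : Matrix (Fin 2) (Fin 2) ℂ) - a • 1‖ ≤
            KV * Real.sqrt (∑ b : PBond (F.P J) 0, dist1 ((GaugeField.gaugeAct s V') b * (V' b)⁻¹) ^ 2) := by
  obtain ⟨KV, t, hKV, ht, H⟩ := exists_antilipschitz_comm_locUnif_of_irr F V hirr
  refine ⟨KV, t, hKV, ht, fun V' hV' s => ⟨Matrix.trace ((s default : Matrix.specialUnitaryGroup (Fin 2) ℂ) : Matrix (Fin 2) (Fin 2) ℂ) / 2, fun y => ?_⟩⟩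
  refine (H V' hV' (fun y => (s y : Matrix (Fin 2) (Fin 2) ℂ)) y).trans (mul_le_mul_of_nonneg_left ?_ hKV)
  refine (pi_norm_le_iff_of_nonneg (Real.sqrt_nonneg _)).mpr fun b => ?_
  rw [norm_comm_sub_eq_dist1]
  exact Real.le_sqrt_of_sq_le
    (Finset.single_le_sum (f := fun b => dist1 ((GaugeField.gaugeAct s V') b * (V' b)⁻¹) ^ 2) (fun b _ => sq_nonneg _) (Finset.mem_univ b))

end Consequences

end Summit.QuantumFields.YangMills.Theorems.FluctuationComparisonRegPrIntLS2BetaNearSymmetryRigidityLocUnif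

end
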